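import Summits.ResolutionOfSingularities.ResolutionOfSingularities.Theorems.BirthCountCutKernels2
import HarnessLib

/-! # BirthCountCutKernels3 — FILE C of the decomp-res-lens-4 g38 node «BirthCountCut» (see the module docstring of
`Theorems/BirthCountCutKernels.lean` = FILE A for the thesis, the law, the cut, the honest tags and the sources). -/

set_option linter.dupNamespace false
set_option linter.unusedSectionVars false

noncomputable section

open CategoryTheory AlgebraicGeometry IsLocalRing TopologicalSpace
open Literature.AlgebraicGeometry.Resolution
open Summit.ResolutionOfSingularities.ResolutionOfSingularities.Theorems
open WeakOrderReduction ForcedTowerClasses DivergentTowerClasses MonomialTowerClasses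
open HugDimensionClasses HugDimensionKernels SurfaceShadowClasses SurfaceShadowKernels
open NearPointCut (SingularClass)
open Scheme.IdealSheafData (vanishingIdeal)

universe u

namespace Summit.ResolutionOfSingularities.ResolutionOfSingularities.Theorems.HugValuationCut

/-! ## ══ FILE C `Theorems/BirthCountCutKernels3.lean` (§122c; cone-free; imports FILE B) ══ -/

section BirthLaw

/-! ### §122c (L2)–(L4) the count law, stabilisation, and the dichotomy ISOLATED ∨ FOLLOWS-A-CURVE -/

variable {k : Type} [Field k]

/-- **the set of near-branches BORN at step `i`** (those of `G'` through `x_{i+1}` inside `π_i⁻¹(x_i)`). -/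
def bornSet (T : ForcedTower) (i a : ℕ) (G' : (T.St (i + 1)).IdealSheafData) : Set (T.St (i + 1)) :=
  {η | η ∈ brSet T (i + 1) a G' ∧ (T.π i).base η = T.pt i}

/-- unfolding: a birth happens iff the born set is non-empty. [folklore] -/
theorem bornAbs_iff_bornSet_nonempty (T : ForcedTower) (i a : ℕ) (G' : (T.St (i + 1)).IdealSheafData) :
    BornAbs T i a G' ↔ (bornSet T i a G').Nonempty :=
  ⟨fun ⟨η, hη, h⟩ => ⟨η, hη, h⟩, fun ⟨η, hη, h⟩ => ⟨η, hη, h⟩⟩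

/-- **(β2) THE COUNT LAW (general step, typed `μ`)**: `μ_{i+1} ≤ μ_i + #(near-branches born at step i)` — the non-born
near-branches upstairs INJECT into the near-branches downstairs (blow-up isomorphism off the centre). [folklore] -/
theorem ncard_brSet_succ_le_add (T : ForcedTower) [∀ i, IsLocallyNoetherian (T.St i)] (i a : ℕ)
    (G : (T.St i).IdealSheafData) (hfin : (brSet T i a G).Finite) :
    (brSet T (i + 1) a (controlledTransform (T.π i) (T.centre i) G a)).ncard ≤
      (brSet T i a G).ncard + (bornSet T i a (controlledTransform (T.π i) (T.centre i) G a)).ncard := by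
  set G' := controlledTransform (T.π i) (T.centre i) G a with hG'
  have hsplit : brSet T (i + 1) a G' = {η | η ∈ brSet T (i + 1) a G' ∧ (T.π i).base η ≠ T.pt i} ∪ bornSet T i a G' := by
    ext η
    simp only [bornSet, Set.mem_union, Set.mem_setOf_eq]
    tauto
  rw [hsplit]
  refine (Set.ncard_union_le _ _).trans (Nat.add_le_add_right ?_ _)
  exact Set.ncard_le_ncard_of_injOn (fun η => (T.π i).base η) (fun η hη => base_mem_brSet_of_ne T i a G hη.1 hη.2)
    (base_injOn_brSet_diff T i a G) hfin

/-- **(β2) THE COUNT LAW, JUNK-FREE in `ℕ∞` (no finiteness hypothesis; typed `μ := Set.encard ∘ brSet`)**: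
`μ_{i+1} ≤ μ_i + #(near-branches born at step i)`. [folklore] -/
theorem encard_brSet_succ_le_add (T : ForcedTower) [∀ i, IsLocallyNoetherian (T.St i)] (i a : ℕ) (G : (T.St i).IdealSheafData) :
    (brSet T (i + 1) a (controlledTransform (T.π i) (T.centre i) G a)).encard ≤
      (brSet T i a G).encard + (bornSet T i a (controlledTransform (T.π i) (T.centre i) G a)).encard := by
  set G' := controlledTransform (T.π i) (T.centre i) G a with hG'
  have hsplit : brSet T (i + 1) a G' = {η | η ∈ brSet T (i + 1) a G' ∧ (T.π i).base η ≠ T.pt i} ∪ bornSet T i a G' := by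
    ext η
    simp only [bornSet, Set.mem_union, Set.mem_setOf_eq]
    tauto
  rw [hsplit]
  exact (Set.encard_union_le _ _).trans (add_le_add
    (Set.encard_le_encard_of_injOn (base_mapsTo_brSet_diff T i a G) (base_injOn_brSet_diff T i a G)) le_rfl)

/-- **(β1) NO INCREASE OFF BIRTHS, JUNK-FREE in `ℕ∞`**: at a birth-free step `μ_{i+1} ≤ μ_i`. [folklore] -/
theorem encard_brSet_succ_le (T : ForcedTower) [∀ i, IsLocallyNoetherian (T.St i)] (i a : ℕ) (G : (T.St i).IdealSheafData)
    (hb : ¬ BornAbs T i a (controlledTransform (T.π i) (T.centre i) G a)) :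
    (brSet T (i + 1) a (controlledTransform (T.π i) (T.centre i) G a)).encard ≤ (brSet T i a G).encard :=
  Set.encard_le_encard_of_injOn (base_mapsTo_brSet_of_not_bornAbs T i a G hb) (base_injOn_brSet_of_not_bornAbs T i a G hb)

/-- **(I∞) ⟹ (FB) (the declared dependence, a THEOREM — pure topology, no base needed)**: an ISOLATED principal companion has
NO near-branches at all from its stage on (a proper generization of `x` meets every open neighbourhood of `x`), hence no
births.  It only says that the birth-recurrent remainder inherits ¬(I∞); the (FB)-half is NOT decided by it. [folklore] -/
theorem birthFree_of_isolatedCompanionTower (T : ForcedTower) (h : IsolatedCompanionTower T) : BirthFreeCompanionTower T := by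
  obtain ⟨m, a, b, H, K, hF, ha, hP, hiso⟩ := h
  refine ⟨m, a, b, H, K, hF, ha, hP, fun j hb => ?_⟩
  obtain ⟨η, hη, -⟩ := hb
  obtain ⟨-, U, hxU, hU⟩ := hiso (j + 1)
  have hηU : η ∈ (U : Set (T.St (m + (j + 1)))) := hη.1.mem_open U.isOpen hxU
  have hηS : η ∈ ((companionMarked T m a H (j + 1)).support : Set (T.St (m + (j + 1)))) :=
    (mem_support_companionMarked_iff T m a H (j + 1) η).mpr hη.2.2
  exact hη.2.1 (hU ⟨hηU, hηS⟩)

/-- **(L4 · CURVE) THE CURVE CHAIN OF A PERSISTENT NEAR-BRANCH.**  If from stage `m₁` on every near-branch of the companion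
chain is hit by a near-branch one stage up (`π_{m₁+d}` maps `branchSet (d+1)` ONTO `branchSet d`), then iterated
preimages of one near-branch `η₀` of `h` at `x_{m₁}` form a chain of points `ζ_i ⤳ x_i`, `ζ_i ≠ x_i`, `π_i ζ_{i+1} = ζ_i`
(`i ≥ m₁`), whose primes `𝔭_{ζ_i} ⊂ 𝒪_{x_i}` are a CURVE CHAIN compatible under the stalk maps; if `dim 𝒪_{x_{m₁}}/𝔭_{η₀}
= 1` the tower FOLLOWS A CURVE GERM (letter (CF∞) of g37, by name). [folklore] -/
theorem followsCurveTower_of_branch_chain (T : ForcedTower) [∀ i, IsLocallyNoetherian (T.St i)] (m₁ a : ℕ)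
    (H₁ : (T.St m₁).IdealSheafData)
    (hsurj : ∀ d, ∀ ζ ∈ branchSet T m₁ a H₁ d, ∃ η ∈ branchSet T m₁ a H₁ (d + 1), (T.π (m₁ + d)).base η = ζ)
    {η₀ : T.St m₁} (hη₀ : η₀ ∈ brSet T m₁ a H₁)
    (hdim : ringKrullDim ((T.St m₁).presheaf.stalk (T.pt m₁) ⧸ primeOfSpecializes hη₀.1) = 1) :
    FollowsCurveTower T := by
  classical
  let step : ∀ ⦃i : ℕ⦄, m₁ ≤ i → T.St i → T.St (i + 1) := fun i _ z =>
    if h : ∃ z' : T.St (i + 1), (T.π i).base z' = z then h.choose else T.pt (i + 1)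
  let ζ : ∀ i, m₁ ≤ i → T.St i := fun i h => Nat.leRec (motive := fun i _ => T.St i) η₀ step h
  have hζ0 : ζ m₁ le_rfl = η₀ := Nat.leRec_self (motive := fun i _ => T.St i) η₀ step
  have hζs : ∀ i (h : m₁ ≤ i), ζ (i + 1) (Nat.le_succ_of_le h) = step h (ζ i h) := fun i h =>
    Nat.leRec_succ (motive := fun i _ => T.St i) η₀ step h
  -- the invariant: the chain runs through the near-branches of the companion chain
  have hinv : ∀ d, ζ (m₁ + d) (Nat.le_add_right m₁ d) ∈ branchSet T m₁ a H₁ d := by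
    intro d
    induction d with
    | zero =>
      show ζ m₁ le_rfl ∈ brSet T m₁ a H₁
      rw [hζ0]
      exact hη₀
    | succ d ih =>
      have hd : m₁ ≤ m₁ + d := Nat.le_add_right m₁ d
      show ζ (m₁ + d + 1) (Nat.le_succ_of_le hd) ∈ branchSet T m₁ a H₁ (d + 1)
      rw [hζs (m₁ + d) hd]
      obtain ⟨η, hη, hηeq⟩ := hsurj d _ ih
      have hex : ∃ z' : T.St (m₁ + d + 1), (T.π (m₁ + d)).base z' = ζ (m₁ + d) hd := ⟨η, hηeq⟩
      have hne : ζ (m₁ + d) hd ≠ T.pt (m₁ + d) := ih.2.1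
      obtain ⟨z, -, hz⟩ :=
        (T.isBlowup (m₁ + d)).existsUnique_preimage_of_not_mem_support (not_mem_centre_support_of_ne hne)
      have hch : hex.choose = η := (hz _ hex.choose_spec).trans (hz _ hηeq).symm
      show (if h : ∃ z' : T.St (m₁ + d + 1), (T.π (m₁ + d)).base z' = ζ (m₁ + d) hd then h.choose
        else T.pt (m₁ + d + 1)) ∈ branchSet T m₁ a H₁ (d + 1)
      rw [dif_pos hex, hch]
      exact hη
  have hsp : ∀ i (h : m₁ ≤ i), ζ i h ⤳ T.pt i := by
    intro i h
    obtain ⟨d, rfl⟩ := Nat.exists_eq_add_of_le h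
    exact (hinv d).1
  have hne : ∀ i (h : m₁ ≤ i), ζ i h ≠ T.pt i := by
    intro i h
    obtain ⟨d, rfl⟩ := Nat.exists_eq_add_of_le h
    exact (hinv d).2.1
  have hπζ : ∀ i (h : m₁ ≤ i), (T.π i).base (ζ (i + 1) (Nat.le_succ_of_le h)) = ζ i h := by
    intro i h
    rw [hζs i h]
    obtain ⟨d, rfl⟩ := Nat.exists_eq_add_of_le h
    obtain ⟨η, -, hηeq⟩ := hsurj d _ (hinv d)
    have hex : ∃ z' : T.St (m₁ + d + 1), (T.π (m₁ + d)).base z' = ζ (m₁ + d) h := ⟨η, hηeq⟩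
    show (T.π (m₁ + d)).base (if h : ∃ z' : T.St (m₁ + d + 1), (T.π (m₁ + d)).base z' = ζ (m₁ + d) h then h.choose
      else T.pt (m₁ + d + 1)) = ζ (m₁ + d) h
    rw [dif_pos hex]
    exact hex.choose_spec
  have hsp' : ∀ i (h : m₁ ≤ i), ζ i h ⤳ (T.π i).base (T.pt (i + 1)) := fun i h => by
    rw [T.pt_map]
    exact hsp i h
  let 𝔮 : ∀ i, Ideal (lineRing T i 0) := fun i => if h : m₁ ≤ i then primeOfSpecializes (hsp' i h) else ⊥
  have h𝔮 : ∀ i (h : m₁ ≤ i), 𝔮 i = primeOfSpecializes (hsp' i h) := fun i h => dif_pos h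
  refine ⟨m₁, 𝔮, fun i hi => ⟨?_, ?_, ?_⟩, ?_⟩
  · rw [h𝔮 i hi]
    infer_instance
  · rw [h𝔮 i hi]
    exact primeOfSpecializes_ne_maximalIdeal_of_ne (hsp' i hi) (by rw [T.pt_map]; exact hne i hi)
  · rw [h𝔮 i hi, h𝔮 (i + 1) (Nat.le_succ_of_le hi)]
    have e := hπζ i hi
    have hmap : (T.π i).base (ζ (i + 1) (Nat.le_succ_of_le hi)) ⤳ (T.π i).base (T.pt (i + 1)) :=
      (hsp (i + 1) (Nat.le_succ_of_le hi)).map (T.π i).continuous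
    rw [← primeOfSpecializes_congr_left e hmap (hsp' i hi)]
    exact comap_stalkMapCongr_primeOfSpecializes (T.π i) (T.pt (i + 1)) ((T.π (i + 1)).base (T.pt (i + 1 + 1)))
      (T.pt_map (i + 1)) (hsp' (i + 1) (Nat.le_succ_of_le hi)) hmap
  · rw [h𝔮 m₁ le_rfl]
    have h1 : η₀ ⤳ (T.π m₁).base (T.pt (m₁ + 1)) := by
      rw [T.pt_map]
      exact hη₀.1
    rw [primeOfSpecializes_congr_left hζ0 (hsp' m₁ le_rfl) h1]
    show ringKrullDim ((T.St m₁).presheaf.stalk ((T.π m₁).base (T.pt (m₁ + 1))) ⧸ primeOfSpecializes h1) = 1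
    rw [ringKrullDim_quotient_primeOfSpecializes_congr_right (T.pt_map m₁) h1 hη₀.1]
    exact hdim

/-- **RECURRENT BIRTHS (the NEGATION of (FB), by mechanism)**: in a birth-recurrent tower every principal factor of weight
`≥ 2` has births at ARBITRARILY LATE steps (re-root the factorization along the factor chain). [folklore] -/
theorem frequently_bornAt_of_not_birthFree (T : ForcedTower) (g : T.St 0 ⟶ Spec (.of k)) (hB : IsBase (T.St 0) g)
    {n : ℕ} (hD : IsDatum n (T.D 0)) (hrec : ¬ BirthFreeCompanionTower T) {m a b : ℕ} {H K : (T.St m).IdealSheafData}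
    (hF : FactorAt T m a b H K) (ha : 2 ≤ a) (hP : (stalkIdeal H (T.pt m)).IsPrincipal) (j₀ : ℕ) :
    ∃ j, j₀ ≤ j ∧ BornAt T m a H j := by
  obtain ⟨j, hj⟩ := (not_birthFreeCompanionTower_iff T).mp hrec (m + j₀) a b (facIter T m a H j₀) (facIter T m b K j₀)
    (hF.forcing T g hB hD j₀) ha (hF.principal_facIter T g hB hD hP j₀).1
  exact ⟨j₀ + j, Nat.le_add_right j₀ j, (bornAt_add_iff T m a H j₀ j).mp hj⟩

/-- **THE BIRTH-COUNT LAW — the DICHOTOMY (KERNEL, PROVED, PORT-FREE; every `p`, every field, every weight)**: in an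
OCCULT forced tower of ring dimension 3, a BIRTH-FREE principal companion either ISOLATES its marked points from some
stage on (letter (I∞) of g36) or makes the tower FOLLOW A CURVE GERM (letter (CF∞) of g37).  Mechanism: the near-branch
count `μ_j = #branchSet_j` is finite ((L1d)), does not increase off births ((β2) `ncard_brSet_succ_le`), so stabilises;
re-rooted at the stabilisation stage, `μ ≡ 0` gives isolation ((L1f)) and `μ ≡ c ≥ 1` gives a bijective transport of
near-branches, hence a persistent curve chain ((L4 · CURVE), (L1e)). (Sources: CossartJannsenSaito2020 §4 p.58 —
old/new components and their transport `O′(x′) = Õ(x) ∩ B′(x′)` —, §10 p.125,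
§13 (13.13) p.141; CossartPiltant2019 p.408 (6.6)–(6.7), p.412 (6.18)–(6.20) — the companion polynomial and its exceptional
factors; Matsumura1987 Thms. 5.1, 14.2, 17.8, 20.3.) -/
theorem isolated_or_followsCurve_of_birthFree (T : ForcedTower) (g : T.St 0 ⟶ Spec (.of k)) (hB : IsBase (T.St 0) g)
    {n : ℕ} (hD : IsDatum n (T.D 0)) (hocc : ¬ LatentFactorTower T) (h3 : ThreefoldTower T)
    (hFB : BirthFreeCompanionTower T) : IsolatedCompanionTower T ∨ FollowsCurveTower T := by
  haveI : ∀ i, IsLocallyNoetherian (T.St i) := fun i => (tower_isLocallyNoetherian_isRegular T g hB i).1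
  obtain ⟨m, a, b, H, K, hF, ha2, hP, hfree⟩ := hFB
  have ha : 1 ≤ a := by omega
  let f : ℕ → ℕ := fun j => (branchSet T m a H j).ncard
  have hfinj : ∀ j, (branchSet T m a H j).Finite := fun j =>
    brSet_finite T g hB hocc h3 (hF.forcing T g hB hD j) (hF.principal_facIter T g hB hD hP j).1 ha
  have hanti : ∀ j, f (j + 1) ≤ f j := fun j =>
    ncard_brSet_succ_le T (m + j) a (facIter T m a H j) (hfinj j) (hfree j)
  have hdesc : ∀ j d, f (j + d) ≤ f j := by
    intro j d
    induction d with
    | zero => exact le_rfl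
    | succ d ih => exact (hanti (j + d)).trans ih
  obtain ⟨j₁, hj₁⟩ : ∃ j₁, ∀ j, f j₁ ≤ f j := ⟨Function.argmin f, fun j => Function.argmin_le f j⟩
  have hconst : ∀ d, f (j₁ + d) = f j₁ := fun d => le_antisymm (hdesc j₁ d) (hj₁ _)
  -- re-root at the stabilisation stage `m₁ = m + j₁`
  have hF₁ := hF.forcing T g hB hD j₁
  have hP₁ := (hF.principal_facIter T g hB hD hP j₁).1
  have hfree₁ := birthFree_add T m a H hfree j₁
  have hfin₁ : ∀ d, (branchSet T (m + j₁) a (facIter T m a H j₁) d).Finite := fun d =>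
    brSet_finite T g hB hocc h3 (hF₁.forcing T g hB hD d) (hF₁.principal_facIter T g hB hD hP₁ d).1 ha
  have hcnt : ∀ d, (branchSet T (m + j₁) a (facIter T m a H j₁) d).ncard = f j₁ := fun d => by
    rw [ncard_branchSet_add]
    exact hconst d
  by_cases hc : f j₁ = 0
  · -- `μ ≡ 0`: THE COMPANION IS ISOLATED from stage `m₁` on
    left
    refine ⟨m + j₁, a, b, facIter T m a H j₁, facIter T m b K j₁, hF₁, ha2, hP₁, fun d => ?_⟩
    have he : branchSet T (m + j₁) a (facIter T m a H j₁) d = ∅ :=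
      (Set.ncard_eq_zero (hfin₁ d)).mp ((hcnt d).trans hc)
    have hsupp : ((companionMarked T (m + j₁) a (facIter T m a H j₁) d).support : Set (T.St (m + j₁ + d))) =
        {y | ((a : ℕ) : ℕ∞) ≤ idealOrder (facIter T (m + j₁) a (facIter T m a H j₁) d) y} :=
      Set.ext fun y => mem_support_companionMarked_iff T (m + j₁) a (facIter T m a H j₁) d y
    rw [hsupp]
    exact isIsolatedIn_of_brSet_eq_empty T g hB (m + j₁ + d) a _ (hF₁.forcing T g hB hD d).2.1.ge he
  · -- `μ ≡ c ≥ 1`: A NEAR-BRANCH PERSISTS — the tower follows a curve germ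
    right
    have hsurj : ∀ d, ∀ ζ ∈ branchSet T (m + j₁) a (facIter T m a H j₁) d,
        ∃ η ∈ branchSet T (m + j₁) a (facIter T m a H j₁) (d + 1), (T.π (m + j₁ + d)).base η = ζ :=
      fun d ζ hζ => exists_preimage_of_ncard_eq T (m + j₁ + d) a (facIter T (m + j₁) a (facIter T m a H j₁) d)
        (hfin₁ d) (hfree₁ d) ((hcnt (d + 1)).trans (hcnt d).symm) hζ
    obtain ⟨η₀, hη₀⟩ : (branchSet T (m + j₁) a (facIter T m a H j₁) 0).Nonempty :=
      Set.nonempty_of_ncard_ne_zero (by rw [hcnt 0]; exact hc)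
    exact followsCurveTower_of_branch_chain T (m + j₁) a (facIter T m a H j₁) hsurj hη₀
      (ringKrullDim_quotient_primeOfSpecializes_eq_one_of_mem_brSet T g hB hocc h3 hF₁ hP₁ ha hη₀)

/-- **THE BIRTH-COUNT LAW (stage form; every `p`, every field, every class `P`, every weight `n`)**: NO occult forced tower
of ring dimension 3 that isolates no companion and follows no curve germ has a birth-free principal companion. [folklore] -/
theorem noTower_occult_threefold_birthFree (n : ℕ) (P : ForcedTower → Prop) :
    NoTower n fun T => ((((P T ∧ ¬ LatentFactorTower T) ∧ ThreefoldTower T) ∧ ¬ IsolatedCompanionTower T) ∧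
      ¬ FollowsCurveTower T) ∧ BirthFreeCompanionTower T := by
  intro p hp K _ _ T g hB hD hE hT
  obtain ⟨⟨⟨⟨⟨-, hocc⟩, h3⟩, hI⟩, hC⟩, hFB⟩ := hT
  rcases isolated_or_followsCurve_of_birthFree T g hB hD hocc h3 hFB with h | h
  exacts [hI h, hC h]

/-- **THE BIRTH-COUNT LAW on the wild column** (`p ∣ n`). [folklore] -/
theorem noTowerWild_occult_threefold_birthFree (n : ℕ) (P : ForcedTower → Prop) :
    NoTowerWild n fun T => ((((P T ∧ ¬ LatentFactorTower T) ∧ ThreefoldTower T) ∧ ¬ IsolatedCompanionTower T) ∧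
      ¬ FollowsCurveTower T) ∧ BirthFreeCompanionTower T := by
  intro p hp hpn K _ _ T g hB hD hE hT
  exact noTower_occult_threefold_birthFree n P p hp K T g hB hD hE hT

end BirthLaw

end Summit.ResolutionOfSingularities.ResolutionOfSingularities.Theorems.HugValuationCut
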